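import Summits.QuantumFields.BalabanUV.Beta.SymmetrisedStepJets
import Summits.QuantumFields.BalabanUV.Beta.FP.PerfectAveragingTables
import Summits.QuantumFields.BalabanUV.Beta.GAN24.T2SlotUnits

/-!
# `BalabanUV.Beta.FP.PerfectBiStencilStep` — road «FP» for binder row D1, row **N1-J∞-W PART 3(a)** (owner d1-p3 g13, journal STAMPS l.31813 (2):
# «part 3 … + the S₂-slot limit equation OPEN — first refusal leaf-02 lineage»), FILE A of 2:
# THE RESCALED RECURSION STEP OF an2's SLOTTED SECOND FIELD TABLES `RecursiveWSlot.T2RecOf G S M cE₂ cB T vh₂S mixFF` IS `j`-INDEPENDENT IN THE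
# ADOPTED UNITS `unitS₂ (sfStep Lc j) (smStep d Lc j)` — `S̃₂_{j+1} = (cE₂·Lc^{2(d+1)}) • e4OfKW Lc G̃_j S̃_j M̃_j (W2SymOfK G̃_j Lc S̃_j M̃_j S̃₂_j M̃₂_j) + cB • vh₂S`,
# MODULO the block shape (ShB₂) of the second-order border table `vh₂S` (displayed) — the `PerfectStencilStep` twin (leaf-06 g12, S-side) on the S₂-side

HONEST DEPENDENCY (page 1, mandatory): continuum YM on T⁴ ⇐ BetaPertH ∧ nine spine estimates (0/9 proved); BetaPertH ⇐ (D1) ∧ (D4) ∧ CAP+tail;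
G-an2-4 gates asym, D1 and NE2/3/4.  HONEST FRAMING (cell contract, verbatim): «discharging `BetaPertH` makes Bałaban's UV stability UNCONDITIONAL —
a real constructive-QFT result; it is NOT the continuum limit and NOT the Clay problem.»  ABSOLUTE RULE (cell charter, verbatim): «No internally-minted
statement may enter as a cited fact. Every hypothesis is either kernel-proved in this package or a verbatim quotation of a PUBLISHED theorem with page
reference. The manuscript(s) under audit are NOT citable for their own disputed steps — they are the thing under adjudication; programme-internal
(2001/route/tribunal) claims are never citable.»  Nothing is cited; no `def`, no `def … : Prop`; no wall binder instantiated; no existing file touched.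

NOT IN PRINT; OUR BOOKKEEPING — [folklore] units algebra over the tree's definitions BY NAME.  HONEST PRIORITY: for an2's Stage-B family `BalabanStepW2.T2Of`
(kernel `KInvStep Lc j` hard-wired, read-out `e4OfW j`, tables `Spure`∕`M1`∕an1's `vh₂S`) the two exponent counts and the normalised recursion are ALREADY
kernel-certified by the G-an2-4 swarm: `GAN24/T2SlotUnits` (gan24-leaf-19 g17: (U-T2-B) `unitS₂_border_eq`, (U-T2-V) `unitS₂_value_eq`, (T2-REC) `unitS₂_T2Of_succ`),
whose `unitS₂` bookkeeping (`unitS₂_add`, `unitS₂_smul_ffOnly`, `unitS₂_border_eq`, `v4_unit_factor`, `smStep_succ_sq_div`) this file IMPORTS AND REUSES.  NEW HERE (row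
N1-J∞-W part 3(a) asks for exactly this): the SLOTTED family `RecursiveWSlot.T2RecOf G S M …` with a GENERIC resolvent slot `G` read through an2's
`SpineRecursiveW.e4OfKW` — the family the (0.4) literal `JsB12Sym` instantiates at `G := Gsym Lc = coDressKSymAt ρ_c Lc ∘ KInvStep Lc` (NOT `KInvStep`), first
tables `SpureSymOf`, multiplier tables `tabs.M` — and the literal's instance with `j`-FREE table slots under (M-H)(ShH)(Shmix).  an2's recursion (`RecursiveWSlot.T2RecOf_succ`, slot form of
`SpineRecursiveW.T2RecAt_succ`): `S₂ (j+1) = (cE₂·wV4 (j+1)) • e4OfKW Lc (G j) (S j) (M j) (WrecOf … j) + (cB·wB2 (j+1)) • vh₂S` with `WrecOf … j = W2SymOfK (G j) Lc (S j)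
(M j) (S₂ j) (M2Of mixFF j)`, `e4OfKW Lc K S M W = mmRead Lc ∘ K3OfK K Lc S M W`, `wV4 n = (Lc^n)^{4(d+2)}`, `wB2 n = (Lc^n)^{3(d+2)}`.  an4's leg units
(`SecondOrderUnits`): `unitS₂ s_f s_m S₂ κ u := (s_f s_m)⁻¹ • unitS s_f s_m (S₂ κ u)` (two `colH` slots), and the covariance facts `mmRead_K3OfK_unit` (the `e4OfW` carrier
rescales by `s_m²` ONLY) and `unitW_W2SymOfK` (the W-carrier is contragredient, NO scalar).  EXPONENT COUNT at `(s_f n, s_m n) = (Lc^n, Lc^{n(d+1)})`: quartic summand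
`(s_f′s_m′)⁻²·s_f′⁻²·wV4 (j+1)·(s_m j)⁻² = Lc^{2(d+1)}` (`quartic_unit_factor`) — the SAME `j`-free weight `Lc^{2(d+1)}` as the cubic summand of the S-side
(`GAN24/SrecUnits.cubic_unit_factor`); border summand `(s_f′s_m′)⁻³·wB2 (j+1) = 1` EXACTLY WHEN `vh₂S` is field–multiplier-valued ((ShB₂): no field–field and no
multiplier–multiplier block — leaf-19's `b2_unit_factor` ∕ `unitS₂_border_eq`).  LOCATED: (ShB₂) holds for an1's VALUE `SecondOrderSocketIdentification.vh₂SAn1`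
(`vh₂SAn1_inl_inl`, `vh₂SAn1_inr_inr`, both `rfl`) but is NOT a field of `SymTables` (which records `hB : ∃ C δ, LocStencil₂ vh₂S C δ` and (TB) only) — the same status as
R-FP-43's (ShV)(ShH) for the first-order tables (`PerfectStencilStep`): displayed here as two letters `hBff hBmm`, discharged by nobody yet; with a field–field component of
`vh₂S` the rescaled border summand would carry the `j`-DEPENDENT factor `(Lc^{j+1})^{d}` — so `j`-independence ⇐ (ShB₂), and nothing weaker is claimed.

## What is proved (generic `d`; blocking factor `Lc` with `NeZero Lc`)
* §1 `e4OfKW_unit` (`e4OfKW Lc (DKD) (unitS S) (unitM M) (unitW W) = s_m² • e4OfKW Lc K S M W`, an4's `mmRead_K3OfK_unit` BY NAME), `e4OfKW_of_units`, the block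
  shape of `e4OfKW` (`mmRead` is field–field-valued), and the scalar `quartic_unit_factor` (= leaf-19's `v4_unit_factor` × `smStep_succ_sq_div`).
* §2 the quartic slotted summand of member `j + 1` in the units of level `j + 1`: **`unitS₂_quarticSlot_eq`** (weight `c·Lc^{2(d+1)}`; `e4OfKW` of the unit-rescaled
  slots of level `j`); the border summand is leaf-19's `T2SlotUnits.unitS₂_border_eq` verbatim ((ShB₂); weight `cB`, NO power of `Lc`).
* §3 **`unitS₂_T2RecOf_succ`** — THE RESCALED STEP (mod (ShB₂)):
  `unitS₂_{j+1} (T2RecOf d Lc G S M cE₂ cB T vh₂S mixFF (j+1)) = fun κ u κ′ u′ ↦ (cE₂·Lc^{2(d+1)}) • e4OfKW Lc G̃_j S̃_j M̃_j (W2SymOfK G̃_j Lc S̃_j M̃_j S̃₂_j M̃₂_j) κ u κ′ u′ + cB • vh₂S κ u κ′ u′`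
  with `G̃_j := unitK_j (G j)`, `S̃_j := unitS_j (S j)`, `M̃_j := unitM_j (M j)`, `S̃₂_j := unitS₂_j (T2RecOf … j)`, `M̃₂_j := unitM₂_j (M2Of d Lc mixFF j)` — ONE map
  `Φ_{S₂}(S̃₂; G̃, S̃, M̃, M̃₂)` in which NO `j` occurs otherwise; `unitS₂_T2RecOf_succ'` (the same with the W-slot left as `unitW_j (WrecOf … j)`).
* §4 the instance for the (0.4) literal's slotted family `T2RecOf d Lc (Gsym Lc) (SpureSymOf tabs cE cVH cΛ) tabs.M cE₂ cB T tabs.vh₂S tabs.mixFF` (`d`, `Lc`, tables, pins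
  generic): `unitS₂_T2RecOf_sym_succ` ((ShB₂) asked of `tabs.vh₂S`) and **`unitS₂_T2RecOf_sym_succ_of_ff`** — with the row root's pin (M-H) `hM1 : tabs.M j = M1Of d Lc tabs.H cΛ j`
  (an2 P2 p268146) and the block-shape letters (ShH) `ffK (tabs.H μ w) = tabs.H μ w`, (Shmix) `ffK (tabs.mixFF κ u ρ w) = tabs.mixFF κ u ρ w` the TABLE slots are `j`-FREE
  too (`PerfectAveragingTables.unitM_M1Of_of_ff` ∕ `unitM₂_M2Of_of_ff`): `M̃_j = cΛ • tabs.H`, `M̃₂_j = tabs.mixFF` — `j` then enters ONLY through `G̃_j`, `S̃_j`, `S̃₂_j`.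
FILE B (`FP/PerfectBiStencilFixedPoint`): continuity of `e4OfKW` along rate families and the passage `j → ∞` — the S₂ FIXED-POINT EQUATION
`S₂∞ = (cE₂·Lc^{2(d+1)}) • e4OfKW Lc G∞ S♭∞ M∞ (W2SymOfK G∞ Lc S♭∞ M∞ S₂∞ M₂∞) + cB • vh₂S`.  Discharges NO (CONV-C) row and NO table letter; 0∕4 row-D1 binders;
NOT N2, NOT D1, NOT `BetaPertH`, NOT continuum, NOT Clay.
Provenance: D1 formalisation swarm LEAF PROVER 02, unit b2b-balaban-beta-d1-formalise-leaf-02 gen 13, 2026-08-21 (journal MINE «N1-J∞-W PART 3(a)»).  Over an2's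
`RecursiveWSlot` ∕ `SpineRecursiveW` ∕ `SymmetrisedStepJets`, an4's `SecondOrderUnits`, gan24-leaf-19's `GAN24/T2SlotUnits`, leaf-02 g12's `PerfectAveragingTables` BY NAME;
no existing file touched.
-/

noncomputable section

open Literature.MathematicalPhysics.QuantumFieldTheory
open Literature.MathematicalPhysics.QuantumFieldTheory.Balaban1983to89
open Literature.MathematicalPhysics.QuantumFieldTheory.Balaban1983to89.Beta
open ExpKernelCalculus (MKer)
open OneStepResolventKernel (Fib)
open BalabanStepJetsSucc (mmRead mmRead_inr_left mmRead_inr_right)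
open BalabanStepW2 (M2Of wV4 wB2)
open SecondOrderResponse (W2SymOfK)
open Summit.QuantumFields.BalabanUV.Beta.HessKerDressedUnits (unitK unitS unitW)
open Summit.QuantumFields.BalabanUV.Beta.SecondOrderUnits (unitM unitS₂ unitM₂ unitW_W2SymOfK mmRead_K3OfK_unit)
open Summit.QuantumFields.BalabanUV.Beta.GAN24.CombesThomas (sfStep smStep sfStep_ne_zero smStep_ne_zero)
open Summit.QuantumFields.BalabanUV.Beta.SpineRooted (e4OfKW T2RecOf WrecOf T2RecOf_succ WrecOf_eq M1Of)
open Summit.QuantumFields.BalabanUV.Beta.SymmetrisedStepJets (SymTables Gsym SpureSymOf)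
open Summit.QuantumFields.BalabanUV.Beta.WardLocusStencils (ffK)
open Summit.QuantumFields.BalabanUV.Beta.FP.PerfectAveragingTables (unitM_M1Of_of_ff unitM₂_M2Of_of_ff)
open Summit.QuantumFields.BalabanUV.Beta.GAN24.T2SlotUnits (unitS₂_add unitS₂_smul_ffOnly unitS₂_border_eq v4_unit_factor smStep_succ_sq_div)

namespace Summit.QuantumFields.BalabanUV.Beta.FP.PerfectBiStencilStep

variable {d : ℕ} {Lc : ℕ} [NeZero Lc]

/-! ## §1 The resolvent-generic fourth value jet in units; the quartic scalar -/

section Units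

/-- [folklore] **THE RESOLVENT-GENERIC FOURTH VALUE JET RESCALES BY `s_m²` ONLY** (an4's `SecondOrderUnits.mmRead_K3OfK_unit` read through an2's
`e4OfKW Lc K S M W = mmRead Lc ∘ K3OfK K Lc S M W`): `e4OfKW Lc (DKD) (unitS S) (unitM M) (unitW W) = s_m² • e4OfKW Lc K S M W`. -/
theorem e4OfKW_unit {sf sm : ℝ} (hsf : sf ≠ 0) (hsm : sm ≠ 0) (K : MKer (d + 1) (Fib d))
    (S M : Fin (d + 1) → (Fin (d + 1) → ℤ) → MKer (d + 1) (Fib d))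
    (W : Fin (d + 1) → (Fin (d + 1) → ℤ) → Fin (d + 1) → (Fin (d + 1) → ℤ) → MKer (d + 1) (Fib d))
    (μ : Fin (d + 1)) (y : Fin (d + 1) → ℤ) (ν : Fin (d + 1)) (y' : Fin (d + 1) → ℤ) :
    e4OfKW Lc (unitK sf sm K) (unitS sf sm S) (unitM sf sm M) (unitW sf sm W) μ y ν y' = (sm * sm) • e4OfKW Lc K S M W μ y ν y' := by
  unfold e4OfKW
  exact mmRead_K3OfK_unit (N := Lc) hsf hsm Lc K S M W μ y ν y'

/-- [folklore] … read backwards, entrywise: `e4OfKW Lc K S M W = (s_m²)⁻¹ ·` the jet through the unit-rescaled slots. -/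
theorem e4OfKW_of_units {sf sm : ℝ} (hsf : sf ≠ 0) (hsm : sm ≠ 0) (K : MKer (d + 1) (Fib d))
    (S M : Fin (d + 1) → (Fin (d + 1) → ℤ) → MKer (d + 1) (Fib d))
    (W : Fin (d + 1) → (Fin (d + 1) → ℤ) → Fin (d + 1) → (Fin (d + 1) → ℤ) → MKer (d + 1) (Fib d))
    (μ : Fin (d + 1)) (y : Fin (d + 1) → ℤ) (ν : Fin (d + 1)) (y' : Fin (d + 1) → ℤ) (x z : Fin (d + 1) → ℤ) (a b : Fib d) :
    e4OfKW Lc K S M W μ y ν y' x z a b =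
      (sm * sm)⁻¹ * e4OfKW Lc (unitK sf sm K) (unitS sf sm S) (unitM sf sm M) (unitW sf sm W) μ y ν y' x z a b := by
  rw [e4OfKW_unit hsf hsm]
  simp only [Pi.smul_apply, smul_eq_mul]
  have h : sm * sm ≠ 0 := mul_ne_zero hsm hsm
  field_simp

omit [NeZero Lc] in
/-- [folklore] `e4OfKW` is field–field-valued (`mmRead` has no multiplier legs): the `(inl, inr)` block vanishes. -/
theorem e4OfKW_inl_inr (K : MKer (d + 1) (Fib d)) (S M : Fin (d + 1) → (Fin (d + 1) → ℤ) → MKer (d + 1) (Fib d))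
    (W : Fin (d + 1) → (Fin (d + 1) → ℤ) → Fin (d + 1) → (Fin (d + 1) → ℤ) → MKer (d + 1) (Fib d))
    (μ : Fin (d + 1)) (y : Fin (d + 1) → ℤ) (ν : Fin (d + 1)) (y' x z : Fin (d + 1) → ℤ) (α m : Fin (d + 1)) :
    e4OfKW Lc K S M W μ y ν y' x z (Sum.inl α) (Sum.inr m) = 0 :=
  mmRead_inr_right Lc _ x z (Sum.inl α) m

omit [NeZero Lc] in
/-- [folklore] … and so does every multiplier row. -/
theorem e4OfKW_inr (K : MKer (d + 1) (Fib d)) (S M : Fin (d + 1) → (Fin (d + 1) → ℤ) → MKer (d + 1) (Fib d))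
    (W : Fin (d + 1) → (Fin (d + 1) → ℤ) → Fin (d + 1) → (Fin (d + 1) → ℤ) → MKer (d + 1) (Fib d))
    (μ : Fin (d + 1)) (y : Fin (d + 1) → ℤ) (ν : Fin (d + 1)) (y' x z : Fin (d + 1) → ℤ) (m : Fin (d + 1)) (b : Fib d) :
    e4OfKW Lc K S M W μ y ν y' x z (Sum.inr m) b = 0 :=
  mmRead_inr_left Lc _ x z m b

/-- [folklore] **(U-E⁗) THE QUARTIC UNIT FACTOR**: `(s_f′s_m′)⁻¹·(s_f′s_m′)⁻¹·s_f′⁻²·(c·wV4 (j+1))·(s_m j)⁻² = c·Lc^{2(d+1)}` at `s_f n = Lc^n`, `s_m n = Lc^{n(d+1)}`,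
`wV4 n = (Lc^n)^{4(d+2)}` — every power of `Lc^j` cancels; `j`-FREE; the SAME weight as the cubic summand of the S-side (`SrecUnits.cubic_unit_factor`).  Glued from
leaf-19's `v4_unit_factor` (residue `s_m′²`) and `smStep_succ_sq_div` (`s_m′²∕s_m² = Lc^{2(d+1)}`). -/
theorem quartic_unit_factor (c : ℝ) (j : ℕ) :
    (sfStep Lc (j + 1) * smStep d Lc (j + 1))⁻¹ * (sfStep Lc (j + 1) * smStep d Lc (j + 1))⁻¹ * ((sfStep Lc (j + 1))⁻¹ * (sfStep Lc (j + 1))⁻¹) *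
        (c * wV4 d Lc (j + 1)) * (smStep d Lc j * smStep d Lc j)⁻¹ = c * (Lc : ℝ) ^ (2 * (d + 1)) := by
  calc (sfStep Lc (j + 1) * smStep d Lc (j + 1))⁻¹ * (sfStep Lc (j + 1) * smStep d Lc (j + 1))⁻¹ * ((sfStep Lc (j + 1))⁻¹ * (sfStep Lc (j + 1))⁻¹) *
        (c * wV4 d Lc (j + 1)) * (smStep d Lc j * smStep d Lc j)⁻¹
      = c * (((sfStep Lc (j + 1) * smStep d Lc (j + 1))⁻¹ * (sfStep Lc (j + 1) * smStep d Lc (j + 1))⁻¹ *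
          ((sfStep Lc (j + 1))⁻¹ * (sfStep Lc (j + 1))⁻¹) * wV4 d Lc (j + 1)) * (smStep d Lc j * smStep d Lc j)⁻¹) := by ring
    _ = c * (Lc : ℝ) ^ (2 * (d + 1)) := by rw [v4_unit_factor (d := d) (Lc := Lc) (j + 1), smStep_succ_sq_div (d := d) (Lc := Lc) j]

end Units

/-! ## §2 The quartic slotted summand of member `j + 1` in the units of level `j + 1` -/

section Pieces

/-- [folklore] **THE QUARTIC SLOT**: `unitS₂_{j+1} ((c·wV4 (j+1)) • e4OfKW Lc G S M W) = (c·Lc^{2(d+1)}) • e4OfKW Lc (unitK_j G) (unitS_j S) (unitM_j M) (unitW_j W)` —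
self-similarity of the quartic summand for a GENERIC resolvent slot `G` (leaf-19's (U-T2-V) `unitS₂_value_eq` is the case `G = KInvStep Lc j`): a `j`-FREE weight times
the SAME read-out through the unit-rescaled slots of level `j` (leaf-19's `unitS₂_smul_ffOnly` — `e4OfKW` is field–field-valued; `e4OfKW_of_units`; `quartic_unit_factor`). -/
theorem unitS₂_quarticSlot_eq (c : ℝ) (j : ℕ) (G : MKer (d + 1) (Fib d)) (S M : Fin (d + 1) → (Fin (d + 1) → ℤ) → MKer (d + 1) (Fib d))
    (W : Fin (d + 1) → (Fin (d + 1) → ℤ) → Fin (d + 1) → (Fin (d + 1) → ℤ) → MKer (d + 1) (Fib d)) :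
    unitS₂ (sfStep Lc (j + 1)) (smStep d Lc (j + 1)) (fun κ u κ' u' => (c * wV4 d Lc (j + 1)) • e4OfKW Lc G S M W κ u κ' u')
      = fun κ u κ' u' => (c * (Lc : ℝ) ^ (2 * (d + 1))) •
          e4OfKW Lc (unitK (sfStep Lc j) (smStep d Lc j) G) (unitS (sfStep Lc j) (smStep d Lc j) S) (unitM (sfStep Lc j) (smStep d Lc j) M)
            (unitW (sfStep Lc j) (smStep d Lc j) W) κ u κ' u' := by
  have hsfj : sfStep Lc j ≠ 0 := sfStep_ne_zero j
  have hsmj : smStep d Lc j ≠ 0 := smStep_ne_zero (d := d) j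
  rw [unitS₂_smul_ffOnly _ _ _ (fun κ u κ' u' => e4OfKW Lc G S M W κ u κ' u') (fun κ u κ' u' x y α ν => e4OfKW_inl_inr G S M W κ u κ' u' x y α ν)
    (fun κ u κ' u' x y ν α => e4OfKW_inr G S M W κ u κ' u' x y ν (Sum.inl α)) (fun κ u κ' u' x y ν ν' => e4OfKW_inr G S M W κ u κ' u' x y ν (Sum.inr ν'))]
  funext κ u κ' u' x z a b
  simp only [Pi.smul_apply, smul_eq_mul]
  rw [e4OfKW_of_units hsfj hsmj G S M W κ u κ' u' x z a b, ← quartic_unit_factor (d := d) (Lc := Lc) c j]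
  ring

end Pieces

/-! ## §3 The rescaled step of the slotted second field tables is `j`-independent -/

section Step

variable (G : ℕ → MKer (d + 1) (Fib d)) (S M : ℕ → Fin (d + 1) → (Fin (d + 1) → ℤ) → MKer (d + 1) (Fib d)) (cE₂ cB : ℝ)
  (T : Fin 4 → Fin 4 → Fin 4 → Fin 4 → ℝ)
  (vh₂S mixFF : Fin (d + 1) → (Fin (d + 1) → ℤ) → Fin (d + 1) → (Fin (d + 1) → ℤ) → MKer (d + 1) (Fib d))

/-- [folklore] **THE RESCALED RECURSION STEP OF `T2RecOf`, W-SLOT UNOPENED** (mod (ShB₂)): in the adopted units of levels `j + 1` resp. `j`,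
`S̃₂_{j+1} = (cE₂·Lc^{2(d+1)}) • e4OfKW Lc G̃_j S̃_j M̃_j (unitW_j (WrecOf … j)) + cB • vh₂S` — every power of `Lc^j` has cancelled. -/
theorem unitS₂_T2RecOf_succ' (hBff : ∀ κ u κ' u' x y (α β : Fin (d + 1)), vh₂S κ u κ' u' x y (Sum.inl α) (Sum.inl β) = 0)
    (hBmm : ∀ κ u κ' u' x y (μ ν : Fin (d + 1)), vh₂S κ u κ' u' x y (Sum.inr μ) (Sum.inr ν) = 0) (j : ℕ) :
    unitS₂ (sfStep Lc (j + 1)) (smStep d Lc (j + 1)) (T2RecOf d Lc G S M cE₂ cB T vh₂S mixFF (j + 1)) = fun κ u κ' u' =>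
      (cE₂ * (Lc : ℝ) ^ (2 * (d + 1))) •
          e4OfKW Lc (unitK (sfStep Lc j) (smStep d Lc j) (G j)) (unitS (sfStep Lc j) (smStep d Lc j) (S j)) (unitM (sfStep Lc j) (smStep d Lc j) (M j))
            (unitW (sfStep Lc j) (smStep d Lc j) (WrecOf d Lc G S M cE₂ cB T vh₂S mixFF j)) κ u κ' u' +
        cB • vh₂S κ u κ' u' := by
  rw [T2RecOf_succ]
  have hsplit : (fun κ u κ' u' =>
      (cE₂ * wV4 d Lc (j + 1)) • e4OfKW Lc (G j) (S j) (M j) (WrecOf d Lc G S M cE₂ cB T vh₂S mixFF j) κ u κ' u' +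
        (cB * wB2 d Lc (j + 1)) • vh₂S κ u κ' u')
      = fun κ u κ' u' => (fun κ u κ' u' => (cE₂ * wV4 d Lc (j + 1)) • e4OfKW Lc (G j) (S j) (M j) (WrecOf d Lc G S M cE₂ cB T vh₂S mixFF j) κ u κ' u') κ u κ' u' +
          (fun κ u κ' u' => (cB * wB2 d Lc (j + 1)) • vh₂S κ u κ' u') κ u κ' u' := rfl
  rw [hsplit, unitS₂_add, unitS₂_quarticSlot_eq cE₂ j (G j) (S j) (M j), unitS₂_border_eq cB vh₂S hBff hBmm (j + 1)]

/-- [folklore] **THE RESCALED RECURSION STEP OF `T2RecOf` IS `j`-INDEPENDENT** (mod (ShB₂)): with the W-slot opened by an4's `unitW_W2SymOfK` (the W-carrier is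
contragredient, NO scalar), `S̃₂_{j+1} = (cE₂·Lc^{2(d+1)}) • e4OfKW Lc G̃_j S̃_j M̃_j (W2SymOfK G̃_j Lc S̃_j M̃_j S̃₂_j M̃₂_j) + cB • vh₂S` with `S̃₂_j := unitS₂_j (T2RecOf … j)`,
`M̃₂_j := unitM₂_j (M2Of d Lc mixFF j)` — the right-hand side is ONE map `Φ_{S₂}(S̃₂; G̃, S̃, M̃, M̃₂)` of the unit-rescaled slots of level `j` in which NO `j` occurs otherwise. -/
theorem unitS₂_T2RecOf_succ (hBff : ∀ κ u κ' u' x y (α β : Fin (d + 1)), vh₂S κ u κ' u' x y (Sum.inl α) (Sum.inl β) = 0)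
    (hBmm : ∀ κ u κ' u' x y (μ ν : Fin (d + 1)), vh₂S κ u κ' u' x y (Sum.inr μ) (Sum.inr ν) = 0) (j : ℕ) :
    unitS₂ (sfStep Lc (j + 1)) (smStep d Lc (j + 1)) (T2RecOf d Lc G S M cE₂ cB T vh₂S mixFF (j + 1)) = fun κ u κ' u' =>
      (cE₂ * (Lc : ℝ) ^ (2 * (d + 1))) •
          e4OfKW Lc (unitK (sfStep Lc j) (smStep d Lc j) (G j)) (unitS (sfStep Lc j) (smStep d Lc j) (S j)) (unitM (sfStep Lc j) (smStep d Lc j) (M j))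
            (W2SymOfK (unitK (sfStep Lc j) (smStep d Lc j) (G j)) Lc (unitS (sfStep Lc j) (smStep d Lc j) (S j)) (unitM (sfStep Lc j) (smStep d Lc j) (M j))
              (unitS₂ (sfStep Lc j) (smStep d Lc j) (T2RecOf d Lc G S M cE₂ cB T vh₂S mixFF j))
              (unitM₂ (sfStep Lc j) (smStep d Lc j) (M2Of d Lc mixFF j))) κ u κ' u' +
        cB • vh₂S κ u κ' u' := by
  rw [unitS₂_T2RecOf_succ' G S M cE₂ cB T vh₂S mixFF hBff hBmm j, WrecOf_eq, unitW_W2SymOfK (sfStep_ne_zero j) (smStep_ne_zero (d := d) j)]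

end Step

/-! ## §4 The instance for the (0.4) literal's slotted family -/

section Literal

variable (tabs : SymTables d Lc) (cE cVH cΛ cE₂ cB : ℝ) (T : Fin 4 → Fin 4 → Fin 4 → Fin 4 → ℝ)

/-- [folklore] **THE LITERAL'S RESCALED S₂-STEP** (slots `(Gsym Lc, SpureSymOf tabs cE cVH cΛ, tabs.M, tabs.vh₂S, tabs.mixFF)` — an2's `SymmetrisedStepJets.WsymOf` ∕
`RecursiveWSlot.T2RecOf`; `d`, `Lc`, tables, pins generic): with (ShB₂) displayed for `tabs.vh₂S`, the step in the adopted units is the `j`-free map of §3. -/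
theorem unitS₂_T2RecOf_sym_succ (hBff : ∀ κ u κ' u' x y (α β : Fin (d + 1)), tabs.vh₂S κ u κ' u' x y (Sum.inl α) (Sum.inl β) = 0)
    (hBmm : ∀ κ u κ' u' x y (μ ν : Fin (d + 1)), tabs.vh₂S κ u κ' u' x y (Sum.inr μ) (Sum.inr ν) = 0) (j : ℕ) :
    unitS₂ (sfStep Lc (j + 1)) (smStep d Lc (j + 1))
        (T2RecOf d Lc (Gsym Lc) (SpureSymOf tabs cE cVH cΛ) tabs.M cE₂ cB T tabs.vh₂S tabs.mixFF (j + 1)) = fun κ u κ' u' =>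
      (cE₂ * (Lc : ℝ) ^ (2 * (d + 1))) •
          e4OfKW Lc (unitK (sfStep Lc j) (smStep d Lc j) (Gsym Lc j)) (unitS (sfStep Lc j) (smStep d Lc j) (SpureSymOf tabs cE cVH cΛ j))
            (unitM (sfStep Lc j) (smStep d Lc j) (tabs.M j))
            (W2SymOfK (unitK (sfStep Lc j) (smStep d Lc j) (Gsym Lc j)) Lc (unitS (sfStep Lc j) (smStep d Lc j) (SpureSymOf tabs cE cVH cΛ j))
              (unitM (sfStep Lc j) (smStep d Lc j) (tabs.M j))
              (unitS₂ (sfStep Lc j) (smStep d Lc j) (T2RecOf d Lc (Gsym Lc) (SpureSymOf tabs cE cVH cΛ) tabs.M cE₂ cB T tabs.vh₂S tabs.mixFF j))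
              (unitM₂ (sfStep Lc j) (smStep d Lc j) (M2Of d Lc tabs.mixFF j))) κ u κ' u' +
        cB • tabs.vh₂S κ u κ' u' :=
  unitS₂_T2RecOf_succ (Gsym Lc) (SpureSymOf tabs cE cVH cΛ) tabs.M cE₂ cB T tabs.vh₂S tabs.mixFF hBff hBmm j

/-- [folklore] **THE LITERAL'S RESCALED S₂-STEP WITH `j`-FREE TABLE SLOTS**: under the row root's pin (M-H) `hM1 : tabs.M j = M1Of d Lc tabs.H cΛ j` (an2,
`RowD1JointEndSymWardTables` p268146) and the block-shape letters (ShH) `ffK (tabs.H μ w) = tabs.H μ w`, (Shmix) `ffK (tabs.mixFF κ u ρ w) = tabs.mixFF κ u ρ w`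
(an1's values are ff-supported; NOT fields of `SymTables`), the unit-rescaled weighted tables are `j`-INDEPENDENT (leaf-02 g12 `PerfectAveragingTables.unitM_M1Of_of_ff`
∕ `unitM₂_M2Of_of_ff`: `M̃_j = cΛ • tabs.H`, `M̃₂_j = tabs.mixFF`), so
`S̃₂_{j+1} = (cE₂·Lc^{2(d+1)}) • e4OfKW Lc G̃_j S̃_j (cΛ•H) (W2SymOfK G̃_j Lc S̃_j (cΛ•H) S̃₂_j mixFF) + cB • vh₂S` — `j` enters ONLY through `G̃_j = unitK_j (Gsym Lc j)`,
`S̃_j = unitS_j (SpureSymOf … j)` and the previous member `S̃₂_j`. -/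
theorem unitS₂_T2RecOf_sym_succ_of_ff (hM1 : ∀ (j : ℕ) (ρ : Fin (d + 1)) (w : Fin (d + 1) → ℤ), tabs.M j ρ w = M1Of d Lc tabs.H cΛ j ρ w)
    (hHff : ∀ μ w, ffK (tabs.H μ w) = tabs.H μ w) (hmixff : ∀ κ u ρ w, ffK (tabs.mixFF κ u ρ w) = tabs.mixFF κ u ρ w)
    (hBff : ∀ κ u κ' u' x y (α β : Fin (d + 1)), tabs.vh₂S κ u κ' u' x y (Sum.inl α) (Sum.inl β) = 0)
    (hBmm : ∀ κ u κ' u' x y (μ ν : Fin (d + 1)), tabs.vh₂S κ u κ' u' x y (Sum.inr μ) (Sum.inr ν) = 0) (j : ℕ) :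
    unitS₂ (sfStep Lc (j + 1)) (smStep d Lc (j + 1))
        (T2RecOf d Lc (Gsym Lc) (SpureSymOf tabs cE cVH cΛ) tabs.M cE₂ cB T tabs.vh₂S tabs.mixFF (j + 1)) = fun κ u κ' u' =>
      (cE₂ * (Lc : ℝ) ^ (2 * (d + 1))) •
          e4OfKW Lc (unitK (sfStep Lc j) (smStep d Lc j) (Gsym Lc j)) (unitS (sfStep Lc j) (smStep d Lc j) (SpureSymOf tabs cE cVH cΛ j))
            (fun μ w => cΛ • tabs.H μ w)
            (W2SymOfK (unitK (sfStep Lc j) (smStep d Lc j) (Gsym Lc j)) Lc (unitS (sfStep Lc j) (smStep d Lc j) (SpureSymOf tabs cE cVH cΛ j))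
              (fun μ w => cΛ • tabs.H μ w)
              (unitS₂ (sfStep Lc j) (smStep d Lc j) (T2RecOf d Lc (Gsym Lc) (SpureSymOf tabs cE cVH cΛ) tabs.M cE₂ cB T tabs.vh₂S tabs.mixFF j))
              tabs.mixFF) κ u κ' u' +
        cB • tabs.vh₂S κ u κ' u' := by
  have hMfun : tabs.M j = M1Of d Lc tabs.H cΛ j := funext fun ρ => funext fun w => hM1 j ρ w
  rw [unitS₂_T2RecOf_sym_succ tabs cE cVH cΛ cE₂ cB T hBff hBmm j, hMfun, unitM_M1Of_of_ff hHff cΛ j, unitM₂_M2Of_of_ff hmixff j]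

end Literal

end Summit.QuantumFields.BalabanUV.Beta.FP.PerfectBiStencilStep

end
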